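import Literature.LinearAlgebra.Matrix.StableLatticeClassesIrreducible
import HarnessLib

/-!
# Finiteness of the classes of `T`-stable lattices, II: every SEMISIMPLE integral `T` — gluing along the primary
# decomposition; «the semisimple matrices in `M_{n×n}(ℤ)` with a fixed characteristic polynomial split into
# finitely many `GL_n(ℤ)`-conjugacy classes» (Jordan–Zassenhaus; Marseglia 2025 (ANTS XVI) §3 Thm. 3.2, Rem. 3.3)

[topic LinearAlgebra/Matrix] Lane `lit-hodgefound` (Track 2 foundations library), seat p15 generation 38, row g38-#5.
Sequel of g38-#4 `StableLatticeClassesIrreducible` (ONE simple factor) and of the correspondence g38-#1/#3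
(`LatimerMacDuffeeStableLattices`, `LatimerMacDuffeeSemisimple`).  THEOREMS ONLY (no definition, no instance, no
named fact; D-0026 net Literature debt `0`; no `sorry`).

## Sources, VERBATIM

S. Marseglia, *Modules over orders, conjugacy classes of integral matrices, and abelian varieties over finite fields*,
Res. Number Theory 11 (2025) (ANTS XVI) [Marseglia2025ModulesOverOrders], §3 (held `paper:arxiv-2208.05409`, chunk
p0006): «Let `K` be an étale algebra over `Q`. This means that `K` is a finite product of separable field extensions
`K_i` of `Q`, say `K = K₁ × … × K_n`. For each `i` we will denote by `𝒪_i` the maximal order of `K_i`. Then the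
maximal order `𝒪` of `K` equals `𝒪 = 𝒪₁ × … × 𝒪_n`. Fix nonnegative integers `s₁, …, s_n` and consider the finitely
generated `K`-module `V = K₁^{s₁} × … × K_n^{s_n}`. Let `R` be an order in `K` and let `𝔣` be the conductor of `R`
in `𝒪`. […] **Theorem 3.2.** Let `M` be in `𝓛(R, V)`. Then there exist an `M′` in `𝓛(R, V)`, and fractional
`𝒪_i`-ideals `I_i` such that (1) `M′ ≃ M` as an `R`-module. (2) `M′𝒪 = ⊕_{i=1}^n (𝒪_i^{s_i−1} ⊕ I_i)`. (3)
`⊕_{i=1}^n (𝔣_i^{s_i−1} ⊕ 𝔣_iI_i) ⊆ M′ ⊆ ⊕_{i=1}^n (𝒪_i^{s_i−1} ⊕ I_i)`, where […] `𝔣 = ⊕_i 𝔣_i` […]. If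
`Q` is a global field […] the quotient `𝒬(I)` is a finite abelian group» (Rem. 3.3, the Jordan–Zassenhaus theorem);
§4 (chunk p0007): «Put `K_m = ℚ[x]/(m) = ∏ ℚ[x]/(m_i)` […] `A` acts on the `K_m`-module `V_c = ∏ (ℚ[x]/(m_i))^{s_i}`
[…] In particular it is semisimple».

C. Hertling, K. Larabi, arXiv:2602.15748 (2026) [HertlingLarabi2026b], §1: «by the Jordan–Zassenhaus theorem [Za38]
the set of semisimple matrices in `M_{n×n}(ℤ)` with a fixed characteristic polynomial splits into finitely many
`GL_n(ℤ)`-conjugacy classes».  I. Reiner, *Maximal Orders* [Reiner2003MaximalOrders], §26 Thm. (26.4)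
(Jordan–Zassenhaus).

## What is formalised (the passage from ONE field `K_i` — g38-#4 — to the product `K = ∏ K_i`)

* §1 `ℤ[T]`-stability of `T`-stable subgroups (`pow_apply_mem`, `aeval_map_apply_mem`); polynomials of the
  restriction of `T` to a `T`-stable subspace (`coe_restrict_pow_apply`, `coe_aeval_restrict`).
* §2 the relation «`L ∼ L′` iff `φ(L) = L′` for a `ℚ`-automorphism `φ` commuting with `T`» is an equivalence
  (`equivalence_rel`); projections onto a `T`-stable complementary pair intertwine `T` with its restrictions
  (`projectionOnto_apply_apply`); images of full lattices (`isLattice_map_projectionOnto`,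
  `span_map_subtype_eq`).
* §3 **THE GLUING STEP (Theorem 3.2 across two factors)** `finite_quot_centralizer_of_isCompl`: if `V = V₁ ⊕ V₂` with
  both summands `T`-stable, `d·π₁(L) ⊆ L` for every `T`-stable subgroup `L` and some integer `d ≠ 0` («`𝔣 ⊆ R`»: the
  idempotents of `K` lie in `d⁻¹ℤ[T]`), and the `T|_{V_i}`-stable lattices of each `V_i` fall into finitely many
  classes, then so do the `T`-stable lattices of `V`: `φ = φ₁ ⊕ φ₂` moves `L` into the window
  `d(N₁ ⊕ N₂) ⊆ φ(L) ⊆ N₁ ⊕ N₂` of a pair of reference lattices, and windows are finite (g38-#4 §1).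
* §4 **THE JORDAN–ZASSENHAUS THEOREM FOR `ℤ[x]/(m)`-LATTICES, `m` square-free**
  `finite_quot_centralizer_of_isSemisimple`: for a SEMISIMPLE `T ∈ End_ℚ(V)` killed by a monic integer polynomial,
  the `T`-stable full `ℤ`-lattices of `V` modulo `C(T)` form a finite type (induction over the irreducible factors
  `P` of `μ_T`: `V = ker P(T) ⊕ ker (μ_T/P)(T)`, Bezout for the projection, g38-#4 on the first summand).
* §5 matrix language: `finite_quot_conj_of_isSemisimple`, `finite_quot_conj_of_minpoly_charpoly` (the printed
  `𝓜_{m,c}(ℤ)/∼_ℤ` is finite, through g38-#3), and the model-free HEADLINE **`finite_quot_conj_semisimple_charpoly`**: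
  for every `n` and every `c ∈ ℤ[x]`, the integer `n × n` matrices that are semisimple over `ℚ` with characteristic
  polynomial `c`, modulo `B ∼ B′ :⟺ PB = B′P` for some `P ∈ GL_n(ℤ)`, form a FINITE type [Za38]; likewise
  `finite_quot_conj_minpoly_charpoly` for `𝓜_{m,c}(ℤ)` with `m` square-free over `ℚ`.

## References
* [Marseglia2025ModulesOverOrders] S. Marseglia, Res. Number Theory 11 (2025), §3 Thm. 3.2, Rem. 3.3; §4 Thm. 4.1. [cite: Marseglia2025ModulesOverOrders, §3 Thm. 3.2, Rem. 3.3, chunk p0006]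
* [HertlingLarabi2026b] C. Hertling, K. Larabi, arXiv:2602.15748, §1 ([Za38] = H. Zassenhaus, Abh. Math. Sem. Hamburg 12 (1938)).
* [Reiner2003MaximalOrders] I. Reiner, *Maximal Orders*, §26 Thm. (26.4).
* [Marseglia2019] S. Marseglia, JLMS 101 (2020) §8 Thm. 8.1 (the correspondence, g38-#3).
-/

noncomputable section

open scoped Classical nonZeroDivisors
open Polynomial Module Submodule

universe u

namespace Literature.LinearAlgebra.Matrix.SemisimpleIntegerMatrixClassesFinite

open Literature.LinearAlgebra.Matrix.StableLatticeClassesIrreducible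
  (finite_setOf_le_of_smul_mem isLattice_map finite_quot_centralizer_of_irreducible)

/-! ## §1 `ℤ[T]`-stability and restriction to a `T`-stable subspace -/

section Basic

variable {V : Type*} [AddCommGroup V] [Module ℚ V]

/-- Powers of `T` preserve a `T`-stable subgroup. [cite: Marseglia2025ModulesOverOrders, §3 («`M′R = M′`»), chunk p0006] -/
theorem pow_apply_mem (T : Module.End ℚ V) {L : Submodule ℤ V} (hL : ∀ x ∈ L, T x ∈ L) (n : ℕ) {x : V}
    (hx : x ∈ L) : (T ^ n) x ∈ L := by
  induction n with
  | zero => simpa using hx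
  | succ n ih => rw [pow_succ', Module.End.mul_apply]; exact hL _ ih

/-- **A `T`-stable subgroup is a `ℤ[T]`-module**: integer polynomials in `T` preserve it. [cite: Marseglia2025ModulesOverOrders, §3 («sub-`R`-modules of `V` which are also lattices»), chunk p0006] -/
theorem aeval_map_apply_mem (T : Module.End ℚ V) {L : Submodule ℤ V} (hL : ∀ x ∈ L, T x ∈ L) (p : ℤ[X])
    {x : V} (hx : x ∈ L) : aeval T (p.map (Int.castRingHom ℚ)) x ∈ L := by
  induction p using Polynomial.induction_on' with
  | add p q hp hq =>
    rw [Polynomial.map_add, map_add, LinearMap.add_apply]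
    exact add_mem hp hq
  | monomial n a =>
    rw [Polynomial.map_monomial, aeval_monomial, Module.End.mul_apply, eq_intCast, Module.algebraMap_end_apply,
      Int.cast_smul_eq_zsmul]
    exact L.smul_mem a (pow_apply_mem T hL n hx)

/-- Powers of the restriction are the restriction of the powers. [cite: Marseglia2025ModulesOverOrders, §4 (proof of Thm. 4.1, «the restriction … induces»), chunk p0008] -/
theorem coe_restrict_pow_apply (T : Module.End ℚ V) {W : Submodule ℚ V} (hW : ∀ x ∈ W, T x ∈ W) (n : ℕ)
    (x : W) : ((((T.restrict hW) ^ n) x : W) : V) = (T ^ n) (x : V) := by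
  induction n generalizing x with
  | zero => simp
  | succ n ih =>
    rw [pow_succ, pow_succ, Module.End.mul_apply, Module.End.mul_apply, ih, LinearMap.coe_restrict_apply]

/-- Polynomials of the restriction are the restriction of the polynomials. [cite: Marseglia2025ModulesOverOrders, §4 (proof of Thm. 4.1), chunk p0008] -/
theorem coe_aeval_restrict (T : Module.End ℚ V) {W : Submodule ℚ V} (hW : ∀ x ∈ W, T x ∈ W) (q : ℚ[X])
    (x : W) : (((aeval (T.restrict hW) q) x : W) : V) = aeval T q (x : V) := by
  induction q using Polynomial.induction_on' with
  | add p q hp hq => simp only [map_add, LinearMap.add_apply, Submodule.coe_add, hp, hq]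
  | monomial n a =>
    simp only [aeval_monomial, Module.End.mul_apply, Module.algebraMap_end_apply, Submodule.coe_smul,
      coe_restrict_pow_apply]

/-- A polynomial that kills `T` kills its restrictions. [cite: Marseglia2025ModulesOverOrders, §4 (proof of Thm. 4.1), chunk p0008] -/
theorem aeval_restrict_eq_zero_of_aeval_eq_zero (T : Module.End ℚ V) {W : Submodule ℚ V}
    (hW : ∀ x ∈ W, T x ∈ W) {q : ℚ[X]} (hq : aeval T q = 0) : aeval (T.restrict hW) q = 0 := by
  ext x
  rw [coe_aeval_restrict, hq, LinearMap.zero_apply, LinearMap.zero_apply, Submodule.coe_zero]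

/-- `q(T|_{ker q(T)}) = 0`. [cite: Marseglia2025ModulesOverOrders, §4 («`V_c = ∏ (ℚ[x]/(m_i))^{s_i}`»), chunk p0007] -/
theorem aeval_restrict_ker_eq_zero (T : Module.End ℚ V) (q : ℚ[X])
    (hW : ∀ x ∈ LinearMap.ker (aeval T q), T x ∈ LinearMap.ker (aeval T q)) : aeval (T.restrict hW) q = 0 := by
  ext x
  rw [coe_aeval_restrict, LinearMap.zero_apply, Submodule.coe_zero]
  exact x.2

/-- `ker q(T)` is `T`-stable. [cite: Marseglia2025ModulesOverOrders, §4 («it is semisimple»), chunk p0007] -/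
theorem apply_mem_ker_aeval (T : Module.End ℚ V) (q : ℚ[X]) {x : V} (hx : x ∈ LinearMap.ker (aeval T q)) :
    T x ∈ LinearMap.ker (aeval T q) := by
  rw [LinearMap.mem_ker] at hx ⊢
  have h := LinearMap.congr_fun (Literature.LinearAlgebra.aeval_mul_eq_mul_aeval_of_commute (rfl : T * T = T * T) q) x
  rw [Module.End.mul_apply, Module.End.mul_apply, hx, map_zero] at h
  exact h

end Basic

/-! ## §2 The relation, projections, images of lattices -/

section Rel

variable {V : Type*} [AddCommGroup V] [Module ℚ V]

/-- **«`≃_R` is an equivalence relation»**: `L ∼ L′ :⟺ φ(L) = L′` for some `ℚ`-automorphism `φ` commuting with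
`T`. [cite: Marseglia2025ModulesOverOrders, §3 («the category `𝓛(R,V)` … with `R`-linear morphisms»; isomorphism classes), chunk p0006] -/
theorem equivalence_rel (T : Module.End ℚ V) :
    Equivalence (fun L L' : {L : Submodule ℤ V // L.IsLattice ℚ ∧ ∀ x ∈ L, T x ∈ L} =>
      ∃ φ : V ≃ₗ[ℚ] V, (φ : V →ₗ[ℚ] V) ∘ₗ T = T ∘ₗ (φ : V →ₗ[ℚ] V) ∧
        L.1.map ((φ : V →ₗ[ℚ] V).restrictScalars ℤ) = L'.1) where
  refl L := by
    refine ⟨LinearEquiv.refl ℚ V, rfl, ?_⟩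
    ext x
    simp
  symm := by
    rintro L L' ⟨φ, hφT, hmap⟩
    refine ⟨φ.symm, ?_, ?_⟩
    · ext x
      apply φ.injective
      have h1 := LinearMap.congr_fun hφT (φ.symm x)
      simp only [LinearMap.coe_comp, Function.comp_apply, LinearEquiv.coe_coe,
        LinearEquiv.apply_symm_apply] at h1 ⊢
      exact h1.symm
    · rw [← hmap, ← Submodule.map_comp]
      have h2 : ((φ.symm : V →ₗ[ℚ] V).restrictScalars ℤ) ∘ₗ ((φ : V →ₗ[ℚ] V).restrictScalars ℤ) =
          LinearMap.id := LinearMap.ext fun x => φ.symm_apply_apply x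
      rw [h2, Submodule.map_id]
  trans := by
    rintro L L' L'' ⟨φ, hφT, hφ⟩ ⟨ψ, hψT, hψ⟩
    refine ⟨φ.trans ψ, ?_, ?_⟩
    · rw [LinearEquiv.coe_trans, LinearMap.comp_assoc, hφT, ← LinearMap.comp_assoc, hψT, LinearMap.comp_assoc]
    · rw [← hψ, ← hφ, ← Submodule.map_comp]
      rfl

variable (T : Module.End ℚ V) {V₁ V₂ : Submodule ℚ V} (h : IsCompl V₁ V₂)
  (h₁ : ∀ x ∈ V₁, T x ∈ V₁) (h₂ : ∀ x ∈ V₂, T x ∈ V₂)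

include h₁ h₂ in
/-- For a `T`-stable complementary pair, **the projection intertwines `T` with `T|_{V₁}`**: `π₁(Tx) = T π₁(x)`. [cite: Marseglia2025ModulesOverOrders, §3 Thm. 3.2 (proof: the components `M′𝒪 = ⊕_i …`), chunk p0006] -/
theorem projectionOnto_apply_apply (x : V) :
    V₁.projectionOnto V₂ h (T x) = T.restrict h₁ (V₁.projectionOnto V₂ h x) := by
  apply Subtype.ext
  rw [LinearMap.coe_restrict_apply]
  conv_lhs => rw [← Submodule.projection_add_projection_eq_self h x, map_add, map_add]
  rw [Submodule.projectionOnto_apply_of_mem_left h (h₁ _ (Submodule.projection_apply_mem h x)),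
    Submodule.projectionOnto_apply_of_mem_right h (h₂ _ (Submodule.projection_apply_mem h.symm x)), add_zero]
  rfl

omit h₁ h₂ in
/-- The projection of a full lattice is a full lattice of the summand. [cite: Marseglia2025ModulesOverOrders, §3 Thm. 3.2 (2), chunk p0006] -/
theorem isLattice_map_projectionOnto {L : Submodule ℤ V} (hL : L.IsLattice ℚ) :
    (L.map ((V₁.projectionOnto V₂ h).restrictScalars ℤ)).IsLattice ℚ := by
  refine ⟨hL.fg.map _, ?_⟩
  have h1 : ((L.map ((V₁.projectionOnto V₂ h).restrictScalars ℤ) : Submodule ℤ V₁) : Set V₁) =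
      (V₁.projectionOnto V₂ h) '' (L : Set V) := Submodule.map_coe _ _
  rw [h1, Submodule.span_image, hL.span_eq_top, Submodule.map_top, Submodule.range_projectionOnto]

/-- A full lattice of a subspace `W`, viewed in `V`, spans `W`. [cite: Marseglia2025ModulesOverOrders, §3 (lattices: «`MQ = V`»), chunk p0006] -/
theorem span_map_subtype_eq {W : Submodule ℚ V} {R : Submodule ℤ W} (hR : R.IsLattice ℚ) :
    Submodule.span ℚ ((R.map (W.subtype.restrictScalars ℤ) : Submodule ℤ V) : Set V) = W := by
  have h1 : ((R.map (W.subtype.restrictScalars ℤ) : Submodule ℤ V) : Set V) = W.subtype '' (R : Set W) :=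
    Submodule.map_coe _ _
  rw [h1, Submodule.span_image, hR.span_eq_top, Submodule.map_top, Submodule.range_subtype]

end Rel

/-! ## §3 The gluing step: two `T`-stable summands -/

section Glue

variable {V : Type*} [AddCommGroup V] [Module ℚ V]

/-- **THEOREM 3.2 ACROSS TWO FACTORS (the gluing step of Jordan–Zassenhaus).**  Let `V = V₁ ⊕ V₂` with both
summands `T`-stable, and let `d ≠ 0` be an integer with `d·π₁(L) ⊆ L` for every `T`-stable subgroup `L` (`π₁` the
projection; «`𝔣 ⊆ R`»).  If for `i = 1, 2` the `T|_{V_i}`-stable full `ℤ`-lattices of `V_i` fall into finitely many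
classes modulo the automorphisms commuting with `T|_{V_i}`, then the `T`-stable full `ℤ`-lattices of `V` fall into
finitely many classes modulo the automorphisms commuting with `T`: with `φ = φ₁ ⊕ φ₂` carrying `π_i(L)` to reference
lattices `N_i`, `d(N₁ ⊕ N₂) ⊆ φ(L) ⊆ N₁ ⊕ N₂` («`𝔣M′𝒪 ⊆ M′ ⊆ M′𝒪`»), and such windows are finite. [cite: Marseglia2025ModulesOverOrders, §3 Thm. 3.2 (1)–(3) and Rem. 3.3, chunk p0006] [cite: Reiner2003MaximalOrders, §26 Thm. (26.4)] -/
theorem finite_quot_centralizer_of_isCompl (T : Module.End ℚ V) {V₁ V₂ : Submodule ℚ V} (h : IsCompl V₁ V₂)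
    (h₁ : ∀ x ∈ V₁, T x ∈ V₁) (h₂ : ∀ x ∈ V₂, T x ∈ V₂) {d : ℤ} (hd : d ≠ 0)
    (hdπ : ∀ L : Submodule ℤ V, (∀ x ∈ L, T x ∈ L) → ∀ x ∈ L, d • V₁.projection V₂ h x ∈ L)
    (hfin₁ : Finite (Quot (fun L L' : {L : Submodule ℤ V₁ // L.IsLattice ℚ ∧ ∀ x ∈ L, T.restrict h₁ x ∈ L} =>
      ∃ φ : V₁ ≃ₗ[ℚ] V₁, (φ : V₁ →ₗ[ℚ] V₁) ∘ₗ T.restrict h₁ = T.restrict h₁ ∘ₗ (φ : V₁ →ₗ[ℚ] V₁) ∧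
        L.1.map ((φ : V₁ →ₗ[ℚ] V₁).restrictScalars ℤ) = L'.1)))
    (hfin₂ : Finite (Quot (fun L L' : {L : Submodule ℤ V₂ // L.IsLattice ℚ ∧ ∀ x ∈ L, T.restrict h₂ x ∈ L} =>
      ∃ φ : V₂ ≃ₗ[ℚ] V₂, (φ : V₂ →ₗ[ℚ] V₂) ∘ₗ T.restrict h₂ = T.restrict h₂ ∘ₗ (φ : V₂ →ₗ[ℚ] V₂) ∧
        L.1.map ((φ : V₂ →ₗ[ℚ] V₂).restrictScalars ℤ) = L'.1))) :
    Finite (Quot (fun L L' : {L : Submodule ℤ V // L.IsLattice ℚ ∧ ∀ x ∈ L, T x ∈ L} =>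
      ∃ φ : V ≃ₗ[ℚ] V, (φ : V →ₗ[ℚ] V) ∘ₗ T = T ∘ₗ (φ : V →ₗ[ℚ] V) ∧
        L.1.map ((φ : V →ₗ[ℚ] V).restrictScalars ℤ) = L'.1)) := by
  classical
  rcases isEmpty_or_nonempty {L : Submodule ℤ V // L.IsLattice ℚ ∧ ∀ x ∈ L, T x ∈ L} with h0 | ⟨⟨M₀⟩⟩
  · exact Finite.of_surjective _ Quot.mk_surjective
  haveI := hfin₁
  haveI := hfin₂
  -- the relations on the summands
  let r₁ := fun L L' : {L : Submodule ℤ V₁ // L.IsLattice ℚ ∧ ∀ x ∈ L, T.restrict h₁ x ∈ L} =>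
    ∃ φ : V₁ ≃ₗ[ℚ] V₁, (φ : V₁ →ₗ[ℚ] V₁) ∘ₗ T.restrict h₁ = T.restrict h₁ ∘ₗ (φ : V₁ →ₗ[ℚ] V₁) ∧
      L.1.map ((φ : V₁ →ₗ[ℚ] V₁).restrictScalars ℤ) = L'.1
  let r₂ := fun L L' : {L : Submodule ℤ V₂ // L.IsLattice ℚ ∧ ∀ x ∈ L, T.restrict h₂ x ∈ L} =>
    ∃ φ : V₂ ≃ₗ[ℚ] V₂, (φ : V₂ →ₗ[ℚ] V₂) ∘ₗ T.restrict h₂ = T.restrict h₂ ∘ₗ (φ : V₂ →ₗ[ℚ] V₂) ∧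
      L.1.map ((φ : V₂ →ₗ[ℚ] V₂).restrictScalars ℤ) = L'.1
  -- reference lattice of a pair of classes: `N = out(q₁) ⊕ out(q₂)`
  let N : Quot r₁ × Quot r₂ → Submodule ℤ V := fun p =>
    (p.1.out.1.map (V₁.subtype.restrictScalars ℤ)) ⊔ (p.2.out.1.map (V₂.subtype.restrictScalars ℤ))
  have hN : ∀ p, (N p).IsLattice ℚ := fun p => by
    refine ⟨(p.1.out.2.1.fg.map _).sup (p.2.out.2.1.fg.map _), ?_⟩
    rw [← top_le_iff, ← h.sup_eq_top]
    refine sup_le ?_ ?_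
    · rw [← span_map_subtype_eq p.1.out.2.1]
      exact Submodule.span_mono fun x hx => Submodule.mem_sup_left hx
    · rw [← span_map_subtype_eq p.2.out.2.1]
      exact Submodule.span_mono fun x hx => Submodule.mem_sup_right hx
  -- the windows are finite (g38-#4 §1)
  haveI : ∀ p, Finite {L : Submodule ℤ V // L ≤ N p ∧ ∀ x ∈ N p, d • x ∈ L} := fun p =>
    (finite_setOf_le_of_smul_mem (N p) (hN p) hd).to_subtype
  let g : (Σ p : Quot r₁ × Quot r₂, {L : Submodule ℤ V // L ≤ N p ∧ ∀ x ∈ N p, d • x ∈ L}) → Quot _ :=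
    fun s => if hL : s.2.1.IsLattice ℚ ∧ ∀ x ∈ s.2.1, T x ∈ s.2.1 then
      Quot.mk (fun L L' : {L : Submodule ℤ V // L.IsLattice ℚ ∧ ∀ x ∈ L, T x ∈ L} =>
        ∃ φ : V ≃ₗ[ℚ] V, (φ : V →ₗ[ℚ] V) ∘ₗ T = T ∘ₗ (φ : V →ₗ[ℚ] V) ∧
          L.1.map ((φ : V →ₗ[ℚ] V).restrictScalars ℤ) = L'.1) ⟨s.2.1, hL⟩
      else Quot.mk _ M₀
  refine Finite.of_surjective g ?_
  rintro ⟨L⟩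
  -- the two projections of `L`
  let L₁ : Submodule ℤ V₁ := L.1.map ((V₁.projectionOnto V₂ h).restrictScalars ℤ)
  let L₂ : Submodule ℤ V₂ := L.1.map ((V₂.projectionOnto V₁ h.symm).restrictScalars ℤ)
  have hL₁ : L₁.IsLattice ℚ ∧ ∀ x ∈ L₁, T.restrict h₁ x ∈ L₁ := by
    refine ⟨isLattice_map_projectionOnto h L.2.1, ?_⟩
    rintro _ ⟨x, hx, rfl⟩
    refine ⟨T x, L.2.2 x hx, ?_⟩
    simp only [LinearMap.restrictScalars_apply]
    exact projectionOnto_apply_apply T h h₁ h₂ x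
  have hL₂ : L₂.IsLattice ℚ ∧ ∀ x ∈ L₂, T.restrict h₂ x ∈ L₂ := by
    refine ⟨isLattice_map_projectionOnto h.symm L.2.1, ?_⟩
    rintro _ ⟨x, hx, rfl⟩
    refine ⟨T x, L.2.2 x hx, ?_⟩
    simp only [LinearMap.restrictScalars_apply]
    exact projectionOnto_apply_apply T h.symm h₂ h₁ x
  let p : Quot r₁ × Quot r₂ := (Quot.mk r₁ ⟨L₁, hL₁⟩, Quot.mk r₂ ⟨L₂, hL₂⟩)
  -- isomorphisms onto the reference lattices of the classes
  obtain ⟨φ₁, hφ₁T, hφ₁⟩ : r₁ ⟨L₁, hL₁⟩ p.1.out :=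
    (equivalence_rel (T.restrict h₁)).symm
      ((equivalence_rel (T.restrict h₁)).eqvGen_iff.mp (Quot.eqvGen_exact (Quot.out_eq p.1)))
  obtain ⟨φ₂, hφ₂T, hφ₂⟩ : r₂ ⟨L₂, hL₂⟩ p.2.out :=
    (equivalence_rel (T.restrict h₂)).symm
      ((equivalence_rel (T.restrict h₂)).eqvGen_iff.mp (Quot.eqvGen_exact (Quot.out_eq p.2)))
  -- `φ = φ₁ ⊕ φ₂`
  obtain ⟨φ, hφ⟩ : ∃ φ : V ≃ₗ[ℚ] V, ∀ x,
      φ x = (φ₁ (V₁.projectionOnto V₂ h x) : V) + (φ₂ (V₂.projectionOnto V₁ h.symm x) : V) :=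
    ⟨(V₁.prodEquivOfIsCompl V₂ h).symm ≪≫ₗ ((φ₁.prodCongr φ₂) ≪≫ₗ V₁.prodEquivOfIsCompl V₂ h), fun x => by
      simp [LinearEquiv.trans_apply, Submodule.prodEquivOfIsCompl_symm_apply]⟩
  have hφ₁T' : ∀ y : V₁, (φ₁ (T.restrict h₁ y) : V) = T (φ₁ y : V) := fun y => by
    have e1 := congrArg Subtype.val (LinearMap.congr_fun hφ₁T y)
    simpa only [LinearMap.coe_comp, Function.comp_apply, LinearEquiv.coe_coe, LinearMap.coe_restrict_apply] using e1
  have hφ₂T' : ∀ y : V₂, (φ₂ (T.restrict h₂ y) : V) = T (φ₂ y : V) := fun y => by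
    have e2 := congrArg Subtype.val (LinearMap.congr_fun hφ₂T y)
    simpa only [LinearMap.coe_comp, Function.comp_apply, LinearEquiv.coe_coe, LinearMap.coe_restrict_apply] using e2
  have hφT : (φ : V →ₗ[ℚ] V) ∘ₗ T = T ∘ₗ (φ : V →ₗ[ℚ] V) := by
    ext x
    simp only [LinearMap.coe_comp, Function.comp_apply, LinearEquiv.coe_coe]
    rw [hφ, hφ, projectionOnto_apply_apply T h h₁ h₂ x, projectionOnto_apply_apply T h.symm h₂ h₁ x, map_add,
      hφ₁T', hφ₂T']
  -- `φ` restricted to the summands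
  have hφ_left : ∀ y : V₁, φ (y : V) = (φ₁ y : V) := fun y => by
    rw [hφ, Submodule.projectionOnto_apply_left, Submodule.projectionOnto_apply_of_mem_right h.symm y.2, map_zero,
      Submodule.coe_zero, add_zero]
  have hφ_right : ∀ y : V₂, φ (y : V) = (φ₂ y : V) := fun y => by
    rw [hφ, Submodule.projectionOnto_apply_left, Submodule.projectionOnto_apply_of_mem_right h y.2, map_zero,
      Submodule.coe_zero, zero_add]
  -- the moved lattice `φ(L)` sits in the window of `N p`
  let L' : Submodule ℤ V := L.1.map ((φ : V →ₗ[ℚ] V).restrictScalars ℤ)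
  have hL'X : L'.IsLattice ℚ ∧ ∀ x ∈ L', T x ∈ L' := by
    refine ⟨isLattice_map (K := ℚ) L.2.1 φ, ?_⟩
    rintro _ ⟨x, hx, rfl⟩
    refine ⟨T x, L.2.2 x hx, ?_⟩
    have e3 := LinearMap.congr_fun hφT x
    simp only [LinearMap.coe_comp, Function.comp_apply, LinearEquiv.coe_coe] at e3
    exact e3
  have hle : L' ≤ N p := by
    rintro _ ⟨x, hx, rfl⟩
    rw [LinearMap.restrictScalars_apply, LinearEquiv.coe_coe, hφ]
    refine Submodule.add_mem_sup ⟨φ₁ (V₁.projectionOnto V₂ h x), ?_, rfl⟩ ⟨φ₂ (V₂.projectionOnto V₁ h.symm x), ?_, rfl⟩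
    · rw [← hφ₁]; exact ⟨_, ⟨x, hx, rfl⟩, rfl⟩
    · rw [← hφ₂]; exact ⟨_, ⟨x, hx, rfl⟩, rfl⟩
  have hge : ∀ x ∈ N p, d • x ∈ L' := by
    intro x hx
    obtain ⟨a, ha, b, hb, rfl⟩ := Submodule.mem_sup.mp hx
    rw [smul_add]
    refine add_mem ?_ ?_
    · obtain ⟨a₁, ha₁, rfl⟩ := ha
      rw [← hφ₁] at ha₁
      obtain ⟨z, ⟨w, hw, rfl⟩, rfl⟩ := ha₁
      -- `d • φ₁(π₁ w) = φ (d • π₁ w)` and `d • π₁ w ∈ L`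
      refine ⟨d • (V₁.projectionOnto V₂ h w : V), hdπ L.1 L.2.2 w hw, ?_⟩
      rw [map_zsmul, LinearMap.restrictScalars_apply, LinearEquiv.coe_coe, hφ_left]
      rfl
    · obtain ⟨b₂, hb₂, rfl⟩ := hb
      rw [← hφ₂] at hb₂
      obtain ⟨z, ⟨w, hw, rfl⟩, rfl⟩ := hb₂
      have hmem : d • (V₂.projectionOnto V₁ h.symm w : V) ∈ L.1 := by
        rw [Submodule.coe_projectionOnto_apply, Submodule.projection_eq_self_sub_projection h, smul_sub]
        exact sub_mem (L.1.smul_mem d hw) (hdπ L.1 L.2.2 w hw)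
      refine ⟨d • (V₂.projectionOnto V₁ h.symm w : V), hmem, ?_⟩
      rw [map_zsmul, LinearMap.restrictScalars_apply, LinearEquiv.coe_coe, hφ_right]
      rfl
  refine ⟨⟨p, L', hle, hge⟩, ?_⟩
  simp only [g, dif_pos hL'X]
  exact (Quot.sound ⟨φ, hφT, rfl⟩).symm

end Glue

/-! ## §4 The Jordan–Zassenhaus theorem for `ℤ[x]/(m)`-lattices, `m` square-free -/

section Main

/-- **THE JORDAN–ZASSENHAUS THEOREM FOR SEMISIMPLE INTEGRAL ENDOMORPHISMS.**  Let `T` be a SEMISIMPLE endomorphism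
of a finite-dimensional `ℚ`-space `V` killed by some monic INTEGER polynomial `c` (e.g. `χ_T ∈ ℤ[x]`); then `V` is a
module over the étale algebra `K = ℚ[x]/(μ_T) = ∏ K_i` and the `T`-stable full `ℤ`-lattices of `V` are the
`ℤ[x]/(μ_T)`-lattices of `𝓛(R, V)`.  **They fall into FINITELY many classes modulo the `ℚ`-automorphisms commuting
with `T`** (`= Aut_K(V)`).  Proof as printed: induction over the simple factors — `V = ker P(T) ⊕ ker (μ_T/P)(T)` for
an irreducible `P ∣ μ_T`, the projection is `(bQ)(T)` with `aP + bQ = 1` so `d·π₁ ∈ ℤ[T]`, ONE field is g38-#4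
(`finite_quot_centralizer_of_irreducible`: Steinitz + `d𝒪_K ⊆ ℤ[θ]`), and the gluing step is
`finite_quot_centralizer_of_isCompl`. [cite: Marseglia2025ModulesOverOrders, §3 Thm. 3.2, Rem. 3.3 (Jordan–Zassenhaus), chunk p0006] [cite: Reiner2003MaximalOrders, §26 Thm. (26.4)] [cite: HertlingLarabi2026b, §1 ([Za38])] -/
theorem finite_quot_centralizer_of_isSemisimple {V : Type u} [AddCommGroup V] [Module ℚ V] [FiniteDimensional ℚ V]
    (T : Module.End ℚ V) (hT : T.IsSemisimple) {c : ℤ[X]} (hc : c.Monic)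
    (hcT : aeval T (c.map (Int.castRingHom ℚ)) = 0) :
    Finite (Quot (fun L L' : {L : Submodule ℤ V // L.IsLattice ℚ ∧ ∀ x ∈ L, T x ∈ L} =>
      ∃ φ : V ≃ₗ[ℚ] V, (φ : V →ₗ[ℚ] V) ∘ₗ T = T ∘ₗ (φ : V →ₗ[ℚ] V) ∧
        L.1.map ((φ : V →ₗ[ℚ] V).restrictScalars ℤ) = L'.1)) := by
  -- strong induction on `dim V`, over all semisimple `S` killed by `c`
  suffices key : ∀ (n : ℕ) (W : Type u) [AddCommGroup W] [Module ℚ W] [FiniteDimensional ℚ W]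
      (S : Module.End ℚ W), finrank ℚ W ≤ n → S.IsSemisimple → aeval S (c.map (Int.castRingHom ℚ)) = 0 →
      Finite (Quot (fun L L' : {L : Submodule ℤ W // L.IsLattice ℚ ∧ ∀ x ∈ L, S x ∈ L} =>
        ∃ φ : W ≃ₗ[ℚ] W, (φ : W →ₗ[ℚ] W) ∘ₗ S = S ∘ₗ (φ : W →ₗ[ℚ] W) ∧
          L.1.map ((φ : W →ₗ[ℚ] W).restrictScalars ℤ) = L'.1)) from
    key _ V T le_rfl hT hcT
  intro n
  induction n with
  | zero =>
    intro W _ _ _ S hn _ _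
    haveI : Subsingleton W := Module.finrank_zero_iff.mp (Nat.le_zero.mp hn)
    haveI : Subsingleton (Submodule ℤ W) := (Submodule.subsingleton_iff ℤ).mpr ‹_›
    exact Finite.of_surjective _ Quot.mk_surjective
  | succ n ih =>
    intro W _ _ _ S hn hS hcS
    classical
    rcases subsingleton_or_nontrivial W with hW | hW
    · haveI : Subsingleton (Submodule ℤ W) := (Submodule.subsingleton_iff ℤ).mpr hW
      exact Finite.of_surjective _ Quot.mk_surjective
    -- an irreducible factor `P` of the (square-free) minimal polynomial `μ = P Q`
    have hμsf : Squarefree (minpoly ℚ S) := hS.minpoly_squarefree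
    obtain ⟨P, hP, Q, hμ⟩ := WfDvdMonoid.exists_irreducible_factor (minpoly.not_isUnit ℚ S) hμsf.ne_zero
    have hμS : aeval S (P * Q) = 0 := by rw [← hμ]; exact minpoly.aeval ℚ S
    by_cases hQ : IsUnit Q
    · -- `μ ~ P`: ONE field, g38-#4
      have hPS : aeval S P = 0 := by
        rw [map_mul] at hμS
        exact (hQ.map (aeval S)).mul_left_eq_zero.mp hμS
      exact finite_quot_centralizer_of_irreducible S hP hPS hc hcS
    -- `V = ker P(S) ⊕ ker Q(S)`, `P`, `Q` coprime
    have hPQ : IsCoprime P Q := by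
      refine (hP.coprime_iff_not_dvd).mpr fun hdvd => hP.1 (hμsf P ?_)
      obtain ⟨k, hk⟩ := hdvd
      exact ⟨k, by rw [hμ, hk, mul_assoc]⟩
    have hcompl : IsCompl (LinearMap.ker (aeval S P)) (LinearMap.ker (aeval S Q)) := by
      refine IsCompl.of_eq (Polynomial.disjoint_ker_aeval_of_isCoprime S hPQ).eq_bot ?_
      rw [Polynomial.sup_ker_aeval_eq_ker_aeval_mul_of_coprime S hPQ, hμS, LinearMap.ker_zero]
    have h₁ : ∀ x ∈ LinearMap.ker (aeval S P), S x ∈ LinearMap.ker (aeval S P) :=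
      fun x hx => apply_mem_ker_aeval S P hx
    have h₂ : ∀ x ∈ LinearMap.ker (aeval S Q), S x ∈ LinearMap.ker (aeval S Q) :=
      fun x hx => apply_mem_ker_aeval S Q hx
    -- Bezout: the projection onto `V₁ = ker P(S)` along `V₂ = ker Q(S)` is `(bQ)(S)`
    obtain ⟨a, b, hab⟩ := id hPQ
    have hproj : ∀ x, (LinearMap.ker (aeval S P)).projection (LinearMap.ker (aeval S Q)) hcompl x =
        aeval S (b * Q) x := fun x => by
      have hx₁ := Submodule.projection_apply_mem hcompl x
      have hx₂ := Submodule.projection_apply_mem hcompl.symm x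
      rw [LinearMap.mem_ker] at hx₁ hx₂
      have e1 : aeval S (b * Q) ((LinearMap.ker (aeval S P)).projection (LinearMap.ker (aeval S Q)) hcompl x) =
          (LinearMap.ker (aeval S P)).projection (LinearMap.ker (aeval S Q)) hcompl x := by
        have hbQ : b * Q = 1 - a * P := by rw [← hab]; ring
        rw [hbQ, map_sub, map_one, LinearMap.sub_apply, Module.End.one_apply, map_mul, Module.End.mul_apply, hx₁,
          map_zero, sub_zero]
      have e2 : aeval S (b * Q) ((LinearMap.ker (aeval S Q)).projection (LinearMap.ker (aeval S P)) hcompl.symm x) =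
          0 := by
        rw [map_mul, Module.End.mul_apply, hx₂, map_zero]
      conv_rhs => rw [← Submodule.projection_add_projection_eq_self hcompl x, map_add, e1, e2, add_zero]
    -- clearing the denominators of `bQ`: `d·π₁ ∈ ℤ[S]`
    obtain ⟨d, hdmem, hd⟩ := IsLocalization.integerNormalization_spec (ℤ⁰) (b * Q)
    have hd0 : (d : ℤ) ≠ 0 := nonZeroDivisors.ne_zero hdmem
    have hdπ : ∀ L : Submodule ℤ W, (∀ x ∈ L, S x ∈ L) → ∀ x ∈ L,
        d • (LinearMap.ker (aeval S P)).projection (LinearMap.ker (aeval S Q)) hcompl x ∈ L := by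
      intro L hL x hx
      have h1 : d • (LinearMap.ker (aeval S P)).projection (LinearMap.ker (aeval S Q)) hcompl x =
          aeval S ((IsLocalization.integerNormalization (ℤ⁰) (b * Q)).map (Int.castRingHom ℚ)) x := by
        rw [hproj]
        conv_rhs => rw [← algebraMap_int_eq, hd, zsmul_eq_mul, map_mul, map_intCast, Module.End.mul_apply,
          Module.End.intCast_apply]
      rw [h1]
      exact aeval_map_apply_mem S hL _ hx
    -- the summands: `P(S₁) = 0` (ONE field, g38-#4), `Q(S₂) = 0` with `Q` square-free and `dim V₂ < dim W` (IH)
    have hPS₁ : aeval (S.restrict h₁) P = 0 := aeval_restrict_ker_eq_zero S P h₁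
    have hQS₂ : aeval (S.restrict h₂) Q = 0 := aeval_restrict_ker_eq_zero S Q h₂
    have hcS₁ : aeval (S.restrict h₁) (c.map (Int.castRingHom ℚ)) = 0 :=
      aeval_restrict_eq_zero_of_aeval_eq_zero S h₁ hcS
    have hcS₂ : aeval (S.restrict h₂) (c.map (Int.castRingHom ℚ)) = 0 :=
      aeval_restrict_eq_zero_of_aeval_eq_zero S h₂ hcS
    have hS₂ : Module.End.IsSemisimple (S.restrict h₂) :=
      Module.End.isSemisimple_of_squarefree_aeval_eq_zero
        (hμsf.squarefree_of_dvd ⟨P, by rw [hμ, mul_comm]⟩) hQS₂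
    have hfin₁ := finite_quot_centralizer_of_irreducible (S.restrict h₁) hP hPS₁ hc hcS₁
    -- `V₁ ≠ 0` (else `P(S)` is invertible and `Q(S) = 0`, so `μ = PQ ∣ Q`), hence `dim V₂ < dim W ≤ n + 1`
    have hV₁ne : LinearMap.ker (aeval S P) ≠ ⊥ := by
      intro hbot
      have hunit : IsUnit (aeval S P) := (LinearMap.isUnit_iff_ker_eq_bot _).mpr hbot
      have hQS : aeval S Q = 0 := by
        rw [map_mul] at hμS
        exact hunit.mul_right_eq_zero.mp hμS
      have hdvd : P * Q ∣ Q := hμ ▸ minpoly.dvd ℚ S hQS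
      obtain ⟨k, hk⟩ := hdvd
      have hQ0 : Q ≠ 0 := fun hQ0 => hμsf.ne_zero (by rw [hμ, hQ0, mul_zero])
      refine hP.1 (IsUnit.of_mul_eq_one k ?_)
      have hk' : Q * 1 = Q * (P * k) := by
        conv_lhs => rw [mul_one, hk]
        ring
      exact (mul_left_cancel₀ hQ0 hk').symm
    have hV₂lt : LinearMap.ker (aeval S Q) ≠ ⊤ := fun htop =>
      hV₁ne (hcompl.disjoint.eq_bot_of_le (htop ▸ le_top))
    have hdim : finrank ℚ (LinearMap.ker (aeval S Q)) ≤ n :=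
      Nat.lt_succ_iff.mp (lt_of_lt_of_le (Submodule.finrank_lt hV₂lt) hn)
    have hfin₂ := ih (LinearMap.ker (aeval S Q)) (S.restrict h₂) hdim hS₂ hcS₂
    exact finite_quot_centralizer_of_isCompl S hcompl h₁ h₂ hd0 hdπ hfin₁ hfin₂

end Main

/-! ## §5 Matrix language: finitely many `GL_n(ℤ)`-classes -/

section Matrices

variable {V : Type*} [AddCommGroup V] [Module ℚ V] [FiniteDimensional ℚ V] {n : ℕ}

/-- **Finitely many `GL_n(ℤ)`-classes of semisimple integer matrices with characteristic polynomial `c = χ_T`**, for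
any semisimple model `(V, T)` with `χ_T = c ∈ ℤ[x]` (g38-#3's bijection composed with
`finite_quot_centralizer_of_isSemisimple`). [cite: Marseglia2025ModulesOverOrders, §3 Thm. 3.2, Rem. 3.3 and §4 Thm. 4.1, chunks p0006–p0008] [cite: HertlingLarabi2026b, §1 ([Za38])] -/
theorem finite_quot_conj_of_isSemisimple (hn : finrank ℚ V = n) (T : Module.End ℚ V) (hT : T.IsSemisimple)
    {c : ℤ[X]} (hc : T.charpoly = c.map (Int.castRingHom ℚ)) :
    Finite (Quot (fun B B' : {B : _root_.Matrix (Fin n) (Fin n) ℤ //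
        Module.End.IsSemisimple (Matrix.toLin' (B.map (Int.castRingHom ℚ))) ∧ B.charpoly = c} =>
      ∃ P : _root_.Matrix (Fin n) (Fin n) ℤ, IsUnit P.det ∧ P * B.1 = B'.1 * P)) := by
  have hcm : c.Monic := by
    refine Polynomial.monic_of_injective (Int.castRingHom ℚ).injective_int ?_
    rw [← hc]; exact T.charpoly_monic
  have hcT : aeval T (c.map (Int.castRingHom ℚ)) = 0 := by rw [← hc]; exact T.aeval_self_charpoly
  haveI := finite_quot_centralizer_of_isSemisimple T hT hcm hcT
  obtain ⟨Φ, -⟩ :=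
    LatimerMacDuffeeSemisimple.exists_equiv_quot_conj_quot_centralizer_of_isSemisimple hn T hT hc
  exact Finite.of_equiv _ Φ.symm

/-- **`𝓜_{m,c}(ℤ)/∼_ℤ` is finite** (the printed index set: `μ_B = m`, `χ_B = c`), for any semisimple model `(V, T)`
with `μ_T = m`, `χ_T = c`. [cite: Marseglia2019, §8 Thm. 8.1, pp. 14–15] [cite: Marseglia2025ModulesOverOrders, §3 Rem. 3.3 and §4 Thm. 4.1, chunks p0006–p0008] -/
theorem finite_quot_conj_of_minpoly_charpoly (hn : finrank ℚ V = n) (T : Module.End ℚ V) (hT : T.IsSemisimple)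
    {m c : ℤ[X]} (hm : minpoly ℚ T = m.map (Int.castRingHom ℚ)) (hc : T.charpoly = c.map (Int.castRingHom ℚ)) :
    Finite (Quot (fun B B' : {B : _root_.Matrix (Fin n) (Fin n) ℤ //
        minpoly ℚ (B.map (Int.castRingHom ℚ)) = m.map (Int.castRingHom ℚ) ∧ B.charpoly = c} =>
      ∃ P : _root_.Matrix (Fin n) (Fin n) ℤ, IsUnit P.det ∧ P * B.1 = B'.1 * P)) := by
  have hcm : c.Monic := by
    refine Polynomial.monic_of_injective (Int.castRingHom ℚ).injective_int ?_
    rw [← hc]; exact T.charpoly_monic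
  have hcT : aeval T (c.map (Int.castRingHom ℚ)) = 0 := by rw [← hc]; exact T.aeval_self_charpoly
  haveI := finite_quot_centralizer_of_isSemisimple T hT hcm hcT
  obtain ⟨Φ, -⟩ :=
    LatimerMacDuffeeSemisimple.exists_equiv_quot_conj_quot_centralizer_of_minpoly_charpoly hn T hT hm hc
  exact Finite.of_equiv _ Φ.symm

/-- **HEADLINE (Jordan–Zassenhaus [Za38], as quoted by Hertling–Larabi): for every `n` and every `c`, the integer
`n × n` matrices that are SEMISIMPLE over `ℚ` with characteristic polynomial `c`, modulo `GL_n(ℤ)`-conjugacy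
(`B ∼ B′ :⟺ PB = B′P`, `P ∈ GL_n(ℤ)`), form a FINITE type.**  (Model-free: if the set is non-empty, any member
`B₀` gives the model `(ℚ^n, B₀)`.) [cite: HertlingLarabi2026b, §1 («the set of semisimple matrices in `M_{n×n}(ℤ)` with a fixed characteristic polynomial splits into finitely many `GL_n(ℤ)`-conjugacy classes» [Za38])] [cite: Marseglia2025ModulesOverOrders, §3 Rem. 3.3, §4 Thm. 4.1] [cite: Reiner2003MaximalOrders, §26 Thm. (26.4)] -/
theorem finite_quot_conj_semisimple_charpoly (n : ℕ) (c : ℤ[X]) :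
    Finite (Quot (fun B B' : {B : _root_.Matrix (Fin n) (Fin n) ℤ //
        Module.End.IsSemisimple (Matrix.toLin' (B.map (Int.castRingHom ℚ))) ∧ B.charpoly = c} =>
      ∃ P : _root_.Matrix (Fin n) (Fin n) ℤ, IsUnit P.det ∧ P * B.1 = B'.1 * P)) := by
  rcases isEmpty_or_nonempty {B : _root_.Matrix (Fin n) (Fin n) ℤ //
      Module.End.IsSemisimple (Matrix.toLin' (B.map (Int.castRingHom ℚ))) ∧ B.charpoly = c} with h0 | ⟨⟨B₀, hB₀, hcB₀⟩⟩
  · exact Finite.of_surjective _ Quot.mk_surjective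
  · refine finite_quot_conj_of_isSemisimple (V := Fin n → ℚ) (Module.finrank_fin_fun ℚ)
      (Matrix.toLin' (B₀.map (Int.castRingHom ℚ))) hB₀ ?_
    rw [Matrix.charpoly_toLin', Matrix.charpoly_map, hcB₀]

/-- **`𝓜_{m,c}(ℤ)/∼_ℤ` is finite for every square-free `m`** (model-free form of
`finite_quot_conj_of_minpoly_charpoly`: integer matrices with `μ_B = m` square-free over `ℚ` and `χ_B = c`).
[cite: Marseglia2019, §8 Thm. 8.1 with Rem. 8.4, pp. 14–15] [cite: Marseglia2025ModulesOverOrders, §3 Rem. 3.3, §4 Thm. 4.1] [cite: HertlingLarabi2026b, §1 ([Za38])] -/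
theorem finite_quot_conj_minpoly_charpoly (n : ℕ) {m : ℤ[X]} (hm : Squarefree (m.map (Int.castRingHom ℚ)))
    (c : ℤ[X]) :
    Finite (Quot (fun B B' : {B : _root_.Matrix (Fin n) (Fin n) ℤ //
        minpoly ℚ (B.map (Int.castRingHom ℚ)) = m.map (Int.castRingHom ℚ) ∧ B.charpoly = c} =>
      ∃ P : _root_.Matrix (Fin n) (Fin n) ℤ, IsUnit P.det ∧ P * B.1 = B'.1 * P)) := by
  rcases isEmpty_or_nonempty {B : _root_.Matrix (Fin n) (Fin n) ℤ //
      minpoly ℚ (B.map (Int.castRingHom ℚ)) = m.map (Int.castRingHom ℚ) ∧ B.charpoly = c} with h0 | ⟨⟨B₀, hB₀, hcB₀⟩⟩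
  · exact Finite.of_surjective _ Quot.mk_surjective
  · have hmin : minpoly ℚ (Matrix.toLin' (B₀.map (Int.castRingHom ℚ))) = m.map (Int.castRingHom ℚ) := by
      rw [Matrix.minpoly_toLin', hB₀]
    have hT : Module.End.IsSemisimple (Matrix.toLin' (B₀.map (Int.castRingHom ℚ))) :=
      Module.End.isSemisimple_of_squarefree_aeval_eq_zero hm (by rw [← hmin]; exact minpoly.aeval ℚ _)
    refine finite_quot_conj_of_minpoly_charpoly (V := Fin n → ℚ) (Module.finrank_fin_fun ℚ)
      (Matrix.toLin' (B₀.map (Int.castRingHom ℚ))) hT hmin ?_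
    rw [Matrix.charpoly_toLin', Matrix.charpoly_map, hcB₀]

end Matrices

end Literature.LinearAlgebra.Matrix.SemisimpleIntegerMatrixClassesFinite
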